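import Literature.NumberTheory.Automorphic.InfUnitaryOneParameterGroupDeriv
import Literature.RepresentationTheory.KonnoKonno2007.RealUnitaryRankOneKAKFibers
import Literature.RepresentationTheory.BorelWallach2000.UpqMaximalCompactBlocks
import HarnessLib

/-!
# The hypotheses `hU0`, `hM`, `hW` of the `KAK`-descended operator family `globOp`, discharged for the data of an
# infinitesimally unitary `(𝔤, K)`-module of `U(α, β)` (`|β| = 1`)

Topic `NumberTheory/Automorphic`; namespaces `Literature.NumberTheory.Automorphic` (§1, matrix level) and
`Literature.NumberTheory.Automorphic.IsPosDefHerm` (§2; sequel of ★ `InfUnitaryOneParameterGroupDeriv` — the unitary one-parameter groups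
`hB.U ρ K X s` on the completion `hB.E`, (U1) `U_zero`, (U5) `kRep_comp_U`, (U6) `U_smul` — and of ★ `RealUnitaryRankOneKAKFibers` — the boost
generator `H₀ = upqUnit (p₀, q₀) (−i)`, its entries `boostUnit_*`, the Weyl element `weylKV p₀`, `coe_kV_weylKV`).  THEOREMS ONLY; no definition, no
instance, no notation, no named fact, no placeholder.  Cell `hodgecm-mathlib`, F0∕P3, in-house road to the letter A6 `HasUnitaryGlobalizationOfInfUnitary`
at `U(2,1)` (ROAD-GLOB v1.1, brick (Φ3-a) «globOp HYPOTHESES FOR (𝔤, K)-MODULE DATA», spec LEAD F0P3b-p01 (g3) 2026-08-31T21:26:11Z; A-p03 (g22)).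

THE STATEMENTS.  ★ Φ1 `RealUnitaryRankOneKAKDescent.globOp_kakMap` (and its companions `globOp_kV`, `globOp_hypV`, `globOp_kV_mul`, `globOp_mul_kV`,
`globOp_mem_unitary`, `continuous_globOp_apply`) take three hypotheses on the pair `(ϖK, U₀)`: (hU0) `U₀ 0 = 1`; (hM) for `m ∈ K = U(α) × U(β)` whose matrix
commutes with `H₀` (and `t > 0`), `ϖK(m) ∘ U₀(t) = U₀(t) ∘ ϖK(m)`; (hW) `ϖK(w) ∘ U₀(t) = U₀(−t) ∘ ϖK(w)` for the Weyl element `w`.  Here they are PROVED for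
`ϖK = hB.kRep ρK hinv` (★ `InfUnitaryHilbertCompletionKAction`) and `U₀ = hB.U ρ K H₀` (★ `InfUnitaryOneParameterGroup`), from: `hV : IsGKModule`,
`hinv` (`K`-invariance of `B`), `0 < K`, `hskew` (skewness of every `ρ X`) and the factorial bound (FB) `hFB` — with EXACTLY the binder shapes of
★ `globOp_kakMap`, so that brick Φ3 passes them verbatim:
* `IsPosDefHerm.U_boostUnit_zero` — (hU0), = ★ `U_zero`;
* `IsPosDefHerm.kRep_comp_U_boostUnit_of_commute` — (hM): ★ (U5) `kRep_comp_U` (`ϖK(k) ∘ U_X(t) = U_{Ad(k)X}(t) ∘ ϖK(k)`, its `Ad`-compatibility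
  premiss being the `(𝔤, K)`-axiom ★ `IsGKModule.ad_compat`) with `Ad(m) H₀ = H₀` (`Ad_kV_boostUnit_of_commute`, from `m H₀ = H₀ m`);
* `IsPosDefHerm.kRep_weyl_comp_U_boostUnit` — (hW): the same with `Ad(w) H₀ = −H₀` (`Ad_weylKV_boostUnit`, from the entrywise identity
  `w H₀ = −H₀ w`, `kV_weylKV_mul_boostUnit`: `w = diag(−1 at inl p₀, 1 elsewhere)`, `H₀ = −i E_{p₀q₀} + i E_{q₀p₀}`), then ★ (U6) `U_smul` with `c = −1`:
  `U_{−H₀}(t) = U_{H₀}(−t)`;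
* `upq_Ad_eq_of_mul_eq` — `Ad(g) X = Y` from `g X = Y g` (★ `RealMatrixGroup.Ad_apply_coe`).
[HarishChandra1953, §9]; [Knapp2002, VII §3 Thm. 7.39 (the `KAK` decomposition and its fibres; `M = Z_K(A)`, the Weyl group of `A`)].

## Mathlib ∕ tree search
Tree: ★ `IsPosDefHerm.U_zero`∕`U_smul`∕`lineBound_of_FB` (`InfUnitaryOneParameterGroup`), ★ `IsPosDefHerm.kRep_comp_U` (`InfUnitaryOneParameterGroupDeriv`),
★ `IsGKModule.ad_compat` (`GKModules`), ★ `RealMatrixGroup.Ad_apply_coe` (`RealMatrixGroups`), ★ `coe_kV_weylKV`, `weylKV` (`RealUnitaryRankOneKAK`),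
★ `boostUnit_inl_inl`∕`_inl_inr`∕`_inr_inl`∕`_inr_inr` (`RealUnitaryRankOneKAKFibers`), ★ `coe_upqMaximalCompactEquiv_symm_apply` (`UpqMaximalCompactBlocks`).
Mathlib: `Matrix.diagonal_mul`, `Matrix.mul_diagonal`, `Units.mul_inv`, `NegMemClass.coe_neg`, `neg_one_smul`.
Dedup: `rg "boostUnit_zero|comp_U_boostUnit|Ad_weylKV|Ad_eq_of_mul_eq" Literature/` — no hits.

## References
* Harish-Chandra, *Representations of a semisimple Lie group on a Banach space. I*, Trans. AMS 75 (1953), §9 [HarishChandra1953].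
* A. W. Knapp, *Lie Groups Beyond an Introduction*, 2nd ed. (2002), I §10 (1.83), VII §3 Thm. 7.39 [Knapp2002].
-/

set_option autoImplicit false

noncomputable section

-- Mathlib idiom (as in ★ `GKModules`, ★ `InfUnitaryOneParameterGroupDeriv`): the commutator bracket on `Module.End ℂ V`, to MENTION
-- `ρ : 𝔤 →ₗ⁅ℝ⁆ End V`.
attribute [local instance 100] LieRing.ofAssociativeRing

open Complex
open scoped Nat InnerProductSpace ComplexConjugate Matrix.Norms.Operator MatrixGroups

namespace Literature.NumberTheory.Automorphic

open Literature.RepresentationTheory.KonnoKonno2007 Literature.RepresentationTheory.KonnoKonno2007.RealDualPair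
open Literature.RepresentationTheory.KonnoKonno2007.RealDualPair.UForm Literature.RepresentationTheory.BorelWallach2000

universe u

/-! ## §1 Matrix level: `Ad(m) H₀ = H₀` for `m ∈ M`, `Ad(w) H₀ = −H₀` for the Weyl element -/

section MatrixLevel

variable {α β : Type*} [Fintype α] [DecidableEq α] [Fintype β] [DecidableEq β] (p₀ : α) (q₀ : β)

/-- `Ad(g) X = Y` in `𝔲(α, β)` as soon as `g X = Y g` (matrices). [cite: Knapp2002, I §10 (1.83)] -/
theorem upq_Ad_eq_of_mul_eq (g : (uFormGroup α β).carrier) {X Y : (uFormGroup α β).lie}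
    (h : ((g : GL (α ⊕ β) ℂ) : Matrix (α ⊕ β) (α ⊕ β) ℂ) * (X : Matrix (α ⊕ β) (α ⊕ β) ℂ) =
      (Y : Matrix (α ⊕ β) (α ⊕ β) ℂ) * ((g : GL (α ⊕ β) ℂ) : Matrix (α ⊕ β) (α ⊕ β) ℂ)) :
    (uFormGroup α β).Ad g X = Y := by
  apply Subtype.ext
  rw [RealMatrixGroup.Ad_apply_coe, h, Matrix.mul_assoc, Units.mul_inv, Matrix.mul_one]


/-- **The Weyl element anticommutes with the boost generator**: `w H₀ = −H₀ w` for `w = kV (weylKV p₀) = diag(−1 at inl p₀, 1 elsewhere)` and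
`H₀ = upqUnit (p₀, q₀) (−i)` (entrywise). [cite: Knapp2002, VII §3 Thm. 7.39] -/
theorem kV_weylKV_mul_boostUnit :
    (((kV α β (weylKV p₀ : KV α β) : UForm α β) : GL (α ⊕ β) ℂ) : Matrix (α ⊕ β) (α ⊕ β) ℂ) *
        ((upqUnit (p₀, q₀) (-I) : (uFormGroup α β).lie) : Matrix (α ⊕ β) (α ⊕ β) ℂ) =
      -((upqUnit (p₀, q₀) (-I) : (uFormGroup α β).lie) : Matrix (α ⊕ β) (α ⊕ β) ℂ) *
        (((kV α β (weylKV p₀ : KV α β) : UForm α β) : GL (α ⊕ β) ℂ) : Matrix (α ⊕ β) (α ⊕ β) ℂ) := by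
  rw [coe_kV_weylKV, Matrix.neg_mul]
  ext i j
  rw [Matrix.diagonal_mul, Matrix.neg_apply, Matrix.mul_diagonal]
  rcases i with a | b <;> rcases j with a' | b'
  · rw [boostUnit_inl_inl, mul_zero, zero_mul, neg_zero]
  · rw [boostUnit_inl_inr, Sum.elim_inl, Sum.elim_inr]
    split_ifs <;> simp_all
  · rw [boostUnit_inr_inl, Sum.elim_inl, Sum.elim_inr]
    split_ifs <;> simp_all
  · rw [boostUnit_inr_inr, mul_zero, zero_mul, neg_zero]

/-- **`Ad(w) H₀ = −H₀`** for the Weyl element `w ∈ K` (read in `K` through ★ `upqMaximalCompactEquiv`). [cite: Knapp2002, VII §3 Thm. 7.39] -/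
theorem Ad_weylKV_boostUnit :
    (uFormGroup α β).Ad (Subgroup.inclusion (uFormGroup α β).maximalCompact_le_carrier (upqMaximalCompactEquiv.symm (weylKV p₀ : KV α β)))
        (upqUnit (p₀, q₀) (-I)) = -upqUnit (p₀, q₀) (-I) := by
  refine upq_Ad_eq_of_mul_eq _ ?_
  rw [NegMemClass.coe_neg, Subgroup.coe_inclusion, coe_upqMaximalCompactEquiv_symm_apply]
  exact kV_weylKV_mul_boostUnit p₀ q₀

/-- **`Ad(m) H₀ = H₀`** for `m ∈ K` whose matrix commutes with `H₀` (`m ∈ M = Z_K(A)`). [cite: Knapp2002, VII §3 Thm. 7.39] -/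
theorem Ad_kV_boostUnit_of_commute (m : KV α β)
    (hcomm : (((kV α β m : UForm α β) : GL (α ⊕ β) ℂ) : Matrix (α ⊕ β) (α ⊕ β) ℂ) *
        ((upqUnit (p₀, q₀) (-I) : (uFormGroup α β).lie) : Matrix (α ⊕ β) (α ⊕ β) ℂ) =
      ((upqUnit (p₀, q₀) (-I) : (uFormGroup α β).lie) : Matrix (α ⊕ β) (α ⊕ β) ℂ) *
        (((kV α β m : UForm α β) : GL (α ⊕ β) ℂ) : Matrix (α ⊕ β) (α ⊕ β) ℂ)) :
    (uFormGroup α β).Ad (Subgroup.inclusion (uFormGroup α β).maximalCompact_le_carrier (upqMaximalCompactEquiv.symm m))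
        (upqUnit (p₀, q₀) (-I)) = upqUnit (p₀, q₀) (-I) :=
  upq_Ad_eq_of_mul_eq _ hcomm

end MatrixLevel

/-! ## §2 The three hypotheses of ★ `globOp_kakMap` for `ϖK = hB.kRep ρK`, `U₀ = hB.U ρ K H₀` -/

namespace IsPosDefHerm

variable {α β : Type*} [Fintype α] [DecidableEq α] [Fintype β] [DecidableEq β] (p₀ : α) (q₀ : β)
  {V : Type u} [AddCommGroup V] [Module ℂ V] {B : V →ₗ⋆[ℂ] V →ₗ[ℂ] ℂ} (hB : IsPosDefHerm B)
include hB

variable {ρK : Representation ℂ (uFormGroup α β).maximalCompact V} {ρ : (uFormGroup α β).lie →ₗ⁅ℝ⁆ Module.End ℂ V}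

/-- **(hU0) `U₀(0) = 1`** for `U₀ = hB.U ρ K H₀` (★ `U_zero`, with skewness and the line bounds from (FB)). [cite: HarishChandra1953, §9] -/
theorem U_boostUnit_zero {K : ℝ} (hK : 0 < K) (hskew : ∀ (X : (uFormGroup α β).lie) (x y : V), B (ρ X x) y = -B x (ρ X y))
    (hFB : ∀ v : V, ∃ C : ℝ, ∀ (m : ℕ) (X : Fin m → (uFormGroup α β).lie),
      ‖hB.emb ((List.ofFn fun i => (ρ (X i) : V →ₗ[ℂ] V)).prod v)‖ ≤ C * m ! * K ^ m * ∏ i, ‖((X i : (uFormGroup α β).lie) : Matrix (α ⊕ β) (α ⊕ β) ℂ)‖) :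
    hB.U ρ K (upqUnit (p₀, q₀) (-I)) 0 = 1 :=
  hB.U_zero hK.le (hskew _) (hB.lineBound_of_FB ρ hFB _)

/-- **(hM) `M`-COMMUTATION**: for `m ∈ K` whose matrix commutes with `H₀` (and any `t`; the premiss `0 < t` of ★ `globOp_kakMap` is not needed),
`ϖK(m) ∘ U₀(t) = U₀(t) ∘ ϖK(m)` — ★ (U5) `kRep_comp_U` with `Ad(m) H₀ = H₀` (`Ad_kV_boostUnit_of_commute`); the `Ad`-compatibility is the `(𝔤, K)`-axiom
★ `IsGKModule.ad_compat`, skewness and line bounds come from `hskew` and (FB).  Binder shape = that of `hM` in ★ `globOp_kakMap`.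
[cite: HarishChandra1953, §9] [cite: Knapp2002, VII §3 Thm. 7.39] -/
theorem kRep_comp_U_boostUnit_of_commute (hV : IsGKModule (uFormGroup α β) ρK ρ)
    (hinv : ∀ (k : (uFormGroup α β).maximalCompact) (x y : V), B (ρK k x) (ρK k y) = B x y)
    {K : ℝ} (hK : 0 < K) (hskew : ∀ (X : (uFormGroup α β).lie) (x y : V), B (ρ X x) y = -B x (ρ X y))
    (hFB : ∀ v : V, ∃ C : ℝ, ∀ (m : ℕ) (X : Fin m → (uFormGroup α β).lie),
      ‖hB.emb ((List.ofFn fun i => (ρ (X i) : V →ₗ[ℂ] V)).prod v)‖ ≤ C * m ! * K ^ m * ∏ i, ‖((X i : (uFormGroup α β).lie) : Matrix (α ⊕ β) (α ⊕ β) ℂ)‖) :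
    ∀ (m : KV α β) (t : ℝ), 0 < t →
      (((kV α β m : UForm α β) : GL (α ⊕ β) ℂ) : Matrix (α ⊕ β) (α ⊕ β) ℂ) *
          ((upqUnit (p₀, q₀) (-I) : (uFormGroup α β).lie) : Matrix (α ⊕ β) (α ⊕ β) ℂ) =
        ((upqUnit (p₀, q₀) (-I) : (uFormGroup α β).lie) : Matrix (α ⊕ β) (α ⊕ β) ℂ) *
          (((kV α β m : UForm α β) : GL (α ⊕ β) ℂ) : Matrix (α ⊕ β) (α ⊕ β) ℂ) →
      hB.kRep ρK hinv (upqMaximalCompactEquiv.symm m) ∘L hB.U ρ K (upqUnit (p₀, q₀) (-I)) t =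
        hB.U ρ K (upqUnit (p₀, q₀) (-I)) t ∘L hB.kRep ρK hinv (upqMaximalCompactEquiv.symm m) := by
  intro m t _ hcomm
  set k : (uFormGroup α β).maximalCompact := upqMaximalCompactEquiv.symm m with hk
  have h := hB.kRep_comp_U hinv hK.le k (hV.ad_compat k (upqUnit (p₀, q₀) (-I))) (hskew _) (hskew _)
    (hB.lineBound_of_FB ρ hFB _) (hB.lineBound_of_FB ρ hFB _) t
  rwa [Ad_kV_boostUnit_of_commute p₀ q₀ m hcomm] at h

/-- **(hW) THE WEYL RELATION**: `ϖK(w) ∘ U₀(t) = U₀(−t) ∘ ϖK(w)` for the Weyl element `w` (★ `weylKV`) — ★ (U5) `kRep_comp_U` with `Ad(w) H₀ = −H₀`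
(`Ad_weylKV_boostUnit`), then ★ (U6) `U_smul` with `c = −1`.  Binder shape = that of `hW` in ★ `globOp_kakMap`. [cite: HarishChandra1953, §9]
[cite: Knapp2002, VII §3 Thm. 7.39] -/
theorem kRep_weyl_comp_U_boostUnit (hV : IsGKModule (uFormGroup α β) ρK ρ)
    (hinv : ∀ (k : (uFormGroup α β).maximalCompact) (x y : V), B (ρK k x) (ρK k y) = B x y)
    {K : ℝ} (hK : 0 < K) (hskew : ∀ (X : (uFormGroup α β).lie) (x y : V), B (ρ X x) y = -B x (ρ X y))
    (hFB : ∀ v : V, ∃ C : ℝ, ∀ (m : ℕ) (X : Fin m → (uFormGroup α β).lie),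
      ‖hB.emb ((List.ofFn fun i => (ρ (X i) : V →ₗ[ℂ] V)).prod v)‖ ≤ C * m ! * K ^ m * ∏ i, ‖((X i : (uFormGroup α β).lie) : Matrix (α ⊕ β) (α ⊕ β) ℂ)‖) :
    ∀ t : ℝ, hB.kRep ρK hinv (upqMaximalCompactEquiv.symm (weylKV p₀ : KV α β)) ∘L hB.U ρ K (upqUnit (p₀, q₀) (-I)) t =
      hB.U ρ K (upqUnit (p₀, q₀) (-I)) (-t) ∘L hB.kRep ρK hinv (upqMaximalCompactEquiv.symm (weylKV p₀ : KV α β)) := by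
  intro t
  set w : (uFormGroup α β).maximalCompact := upqMaximalCompactEquiv.symm (weylKV p₀ : KV α β) with hw
  have h := hB.kRep_comp_U hinv hK.le w (hV.ad_compat w (upqUnit (p₀, q₀) (-I))) (hskew _) (hskew _)
    (hB.lineBound_of_FB ρ hFB _) (hB.lineBound_of_FB ρ hFB _) t
  rw [Ad_weylKV_boostUnit p₀ q₀, ← neg_one_smul ℝ (upqUnit (p₀, q₀) (-I) : (uFormGroup α β).lie),
    hB.U_smul hK.le (hskew _) (hB.lineBound_of_FB ρ hFB _) (-1) t, neg_one_mul] at h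
  exact h

end IsPosDefHerm

end Literature.NumberTheory.Automorphic

end
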